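import Summits.AtomisticToContinuum.Crystallization.Theorems.FrustratedLawDichotomySymSharing
import Summits.AtomisticToContinuum.Crystallization.Theorems.FrustratedLawDichotomyAtlasReachErgodic
import Summits.AtomisticToContinuum.Crystallization.Theorems.FrustratedLawDichotomyTextureAllBad
import Summits.AtomisticToContinuum.Crystallization.Theorems.RepetitiveNetworkReductionRecurrentMemberDefs

/-!
# FrustratedLawDichotomy · crux `AperiodicFrustratedLawGap` (stmt-AtomisticToContinuum-27623) — THE TEXTURED SLOTS:
# floors, cap and strict gap read ONLY at TEXTURED Nash roots (decomp-a2c, prover hand 1, generation 60; def-free)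

THE POINT.  Every reach theorem of the (404) line — (404) `…AtlasReach.coherentMassExclusion_of_floors`, #132
`…AtlasReachLedger.coherentMassExclusion_of_floorsL`, (404′), (473) `…SymSharing.coherentMassExclusion_of_symAvg` and its strict door
`aperiodicFrustratedLawGap_of_symGap` — asks its row FLOORS and its CAP / GAP at every rooted `7/10`-hard-core NASH configuration (off the rows).
Those slots are TEXTURE-BLIND: the binder list of `NoAdmissibleMinimiserWith` carries clause (d) of the crux (`∃ R₇ R₈ R₉, ∀ᵐ μ ∂P, Appr μ R₇ R₈ R₉`),
and the tree transfers it to the charged configuration (hand 1, generation 4: `…TextureAllBad.not_robustGood_of_texture` — NO atom is robustly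
`1/20`-good), but no slot lets a certificate use it.  Two standing verdicts on the K2′ lane are consequences of exactly this blindness:
* «every averaged cap implies a global `e⋆` floor (E⋆-LB)» (crit-1 r1943 (1)): the corollary evaluates the cap on Palm laws of near-optimal PERIODIC
  CLOSE PACKINGS — robustly GOOD configurations, where no admissible law of the crux has mass;
* «the strict gap is false-leaning: near-clean Nash charts read `symAvgEnergy` within `10⁻⁴` of `e⋆`» (r1939 (B)): near-clean = `1/20`-good.
This file threads the texture through the slots.  The TEXTURED SLOT antecedent is
  `IsRootedHardCore (7/10) μ ∧ NashM μ ∧ (∃ R₇ R₈ R₉, ApprM μ R₇ R₈ R₉)`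
(`NashM`, `ApprM` = the route's `let`s as definitions, `…RecurrentMemberDefs`, bodies verbatim), i.e. exactly the almost-sure profile the binder list
grants at configuration level.  Consequences, all proved here by the proofs of #132 / (473) with one more `filter_upwards` clause:
* §1 `reducedTexture_of_apprM`, ★ `not_robustGood_of_apprM` — what the textured antecedent hands a certifier RADIUS-FREE (the radii of clause (d) are the
  law's and unknown): separation, two-way matchings, and NO ROBUSTLY `1/20`-GOOD ATOM anywhere (fcc nor hcp; hand 1's transfer, by name);
  `not_apprM_of_robustGood` — conversely a configuration with one robustly good atom is OUTSIDE the textured slot: so are all periodic close packings and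
  their small affine strains (the carriers of the (E⋆-LB) corollary), uniformly compressed or dilated close packings (`Gy` is scale-free) and the far field
  of the coherent radial-compression family of the desk (lens-5 SYMCUR §5, `e_fcc − 0.019`); the disordered dense clusters of the Negative price sheet
  ((410), (434), `…OffAtlasCapCeilingDenseField`) are already outside the NASH-shrunk slots of #132 and are not claimed to be untextured;
* §2 ★★ `coherentMassExclusion_of_floorsL_textured` — #132 §2 with the textured antecedent in BOTH slots (any admissible null ledger `Φ`);
* §3 symmetric currency: ★★ `coherentMassExclusion_of_symAvg_textured`, the junction `aperiodicFrustratedLawGap_of_offAtlasMassGap_symAvg_textured`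
  ((404) `aperiodicFrustratedLawGap_of_massSplit`, by name), and the energy–mass inequality `offAtlasMass_ge_of_symAvg_textured` (clauses (a)(b)(d)(e));
* §5 composition with the ERGODIC residual of hand 2's #135 (`…AtlasReachErgodic`, texture on the F side, ergodicity on the A side — both a.s. clauses of the
  same binder list): `aperiodicFrustratedLawGap_of_ergodicOffAtlasMassGap_symAvg_textured`; and the kernel-checked weakening direction as a USE
  `example` ((473)'s texture-blind strict-door hypotheses feed the textured door verbatim).
* §4 ★★ THE TEXTURED STRICT DOOR `aperiodicFrustratedLawGap_of_texturedSymGap` (rows + a strict gap `e⋆ + g ≤ symAvgEnergy r μ` at textured Nash roots off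
  the rows ⟹ crux, A-free) and its row-free case ★ `aperiodicFrustratedLawGap_of_texturedLocalGap`:
    «LOCAL FRUSTRATION INEQUALITY (LFI)(r, g)»  every rooted `7/10`-hard-core, Nash, TEXTURED configuration has `symAvgEnergy r μ ≥ e⋆ + g`
  ⟹ `AperiodicFrustratedLawGap`.  (LFI) is law-free, `e⋆`-free for a certifier (discharge `eUp + g ≤ symAvgEnergy` with the tree ceiling
  `e⋆ ≤ eUp`), implies NO bound on `e⋆`, and its binding adversary is no longer density or near-clean charts but the cheapest ALL-`1/20`-BAD Nash
  environment (desk, hand-1 g60 `num/kappa_aff.py`: the close packings affinely strained to the badness threshold, `≈ 4·10⁻³` above `e_fcc` at `r = 11/10`).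
HONEST LABELS.  Junction / bookkeeping; WEAKER hypotheses for every future certificate, same conclusions; no numeric `D`, `m`, `g` claimed; A(η) untouched;
(LFI) UNDECIDED (TRUE-leaning on the desk with margin `≈ 4·10⁻³`, not `10⁻⁴`), INSTRUMENTABLE only box-by-box.  DEF-FREE; imports TREE (473) `…SymSharing`,
#135 `…AtlasReachErgodic`, `…TextureAllBad`, `…RecurrentMemberDefs`; no instance / notation / option; 0 sorry.  Tags: [new: junction]; §1 [folklore].
-/

noncomputable section

namespace Summit.AtomisticToContinuum.Crystallization.Theorems.FrustratedLawDichotomyAtlasReachTextured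

open MeasureTheory Metric Set Filter ProbabilityTheory
open scoped ENNReal BigOperators
open Literature.MathematicalPhysics.StatisticalMechanics Literature.Probability.Process
open Summit.AtomisticToContinuum.Crystallization.Theorems.ChargedEnergyGapNegative (E3 eStar)
open Summit.AtomisticToContinuum.Crystallization.Theorems.RepetitiveNetworkReductionRecurrentMember (Gy TexBall ApprM NashM)
open Summit.AtomisticToContinuum.Crystallization.Theorems.FrustratedLawDichotomyFiniteClusterGap (integrable_rootEnergy_of_ae_hardCore)
open Summit.AtomisticToContinuum.Crystallization.Theorems.FrustratedLawDichotomySignedLedger (net)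
open Summit.AtomisticToContinuum.Crystallization.Theorems.FrustratedLawDichotomyTransportPriceSurplus (exists_measurable_rootEnergy_surrogate)
open Summit.AtomisticToContinuum.Crystallization.Theorems.FrustratedLawDichotomyAtlasReach
  (reach NoAdmissibleMinimiserWith CoherentMassExclusion OffAtlasMassGap aperiodicFrustratedLawGap_of_massSplit)
open Summit.AtomisticToContinuum.Crystallization.Theorems.FrustratedLawDichotomyAtlasReachLedger
  (lt_integral_rootEnergy_of_massLedger offAtlasMass_ge_of_atlasLedger)
open Summit.AtomisticToContinuum.Crystallization.Theorems.FrustratedLawDichotomySymSharing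
  (symShare symAvgEnergy transported_eq_symAvgEnergy symShare_nullLedger extendRow extendMargin measurableSet_extendRow iUnion_extendRow_eq_univ
    noAdmissibleMinimiserWith_of_forall_not)
open Summit.AtomisticToContinuum.Crystallization.Theorems.FrustratedLawDichotomyAtlasReachErgodic (aperiodicFrustratedLawGap_of_massSplit_ergodic)
open Summit.AtomisticToContinuum.Crystallization.Theorems.FrustratedLawDichotomyTextureAllBad (not_robustGood_of_texture)

/-! ## §1. What the textured antecedent hands a certifier, radius-free -/

/-- `ApprM μ R₇ R₈ R₉` (clause (d) at configuration level) contains the REDUCED texture hypothesis of `…TextureAllBad.not_robustGood_of_texture`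
(separation, clause (2) «all sites `1/20`-bad», the two matching clauses) — clauses (3)–(5) dropped. [folklore] -/
theorem reducedTexture_of_apprM {μ : Measure E3} {R₇ R₈ R₉ : ℝ} (h : ApprM μ R₇ R₈ R₉) :
    ∀ q : EuclideanSpace ℝ (Fin 3), μ {q} ≠ 0 → ∀ R ε : ℝ, 0 < ε → ∃ (N : ℕ) (y : Fin N → EuclideanSpace ℝ (Fin 3)) (i : Fin N),
      (∀ a b : Fin N, a ≠ b → (7 : ℝ) / 10 ≤ dist (y a) (y b)) ∧
      (∀ j : Fin N, dist (y j) (y i) ≤ R → ¬ ∃ A : EuclideanSpace ℝ (Fin 3) →ₗᵢ[ℝ] EuclideanSpace ℝ (Fin 3),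
          (∃ e : ↥{z : EuclideanSpace ℝ (Fin 3) | z ∈ Set.range y ∧ z ≠ y j ∧ dist z (y j) < 13 / 10 * sInf ((fun z => dist z (y j)) '' (Set.range y \ {y j}))} ≃ ↥Literature.Geometry.DiscreteGeometry.fccKissingPattern, ∀ t : ↥{z : EuclideanSpace ℝ (Fin 3) | z ∈ Set.range y ∧ z ≠ y j ∧ dist z (y j) < 13 / 10 * sInf ((fun z => dist z (y j)) '' (Set.range y \ {y j}))}, dist ((sInf ((fun z => dist z (y j)) '' (Set.range y \ {y j})))⁻¹ • ((t : EuclideanSpace ℝ (Fin 3)) - y j)) (A ((e t : ↥Literature.Geometry.DiscreteGeometry.fccKissingPattern) : EuclideanSpace ℝ (Fin 3))) ≤ 1 / 20) ∨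
          (∃ e : ↥{z : EuclideanSpace ℝ (Fin 3) | z ∈ Set.range y ∧ z ≠ y j ∧ dist z (y j) < 13 / 10 * sInf ((fun z => dist z (y j)) '' (Set.range y \ {y j}))} ≃ ↥Literature.Geometry.DiscreteGeometry.hcpKissingPattern, ∀ t : ↥{z : EuclideanSpace ℝ (Fin 3) | z ∈ Set.range y ∧ z ≠ y j ∧ dist z (y j) < 13 / 10 * sInf ((fun z => dist z (y j)) '' (Set.range y \ {y j}))}, dist ((sInf ((fun z => dist z (y j)) '' (Set.range y \ {y j})))⁻¹ • ((t : EuclideanSpace ℝ (Fin 3)) - y j)) (A ((e t : ↥Literature.Geometry.DiscreteGeometry.hcpKissingPattern) : EuclideanSpace ℝ (Fin 3))) ≤ 1 / 20)) ∧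
      (∀ s : EuclideanSpace ℝ (Fin 3), μ {s} ≠ 0 → dist s q ≤ R → ∃ a : Fin N, dist (y a - y i) (s - q) ≤ ε) ∧
      (∀ a : Fin N, dist (y a) (y i) ≤ R → ∃ s : EuclideanSpace ℝ (Fin 3), μ {s} ≠ 0 ∧ dist (y a - y i) (s - q) ≤ ε) := by
  intro q hq R ε hε
  obtain ⟨N, y, i, ⟨hsep, h2, -, -, -⟩, hm1, hm2⟩ := h q hq R ε hε
  exact ⟨N, y, i, hsep, h2, hm1, hm2⟩

/-- ★ **NO ROBUSTLY GOOD ATOM IN THE TEXTURED SLOT** (hand 1's texture transfer II, by name): a rooted `δ`-hard-core configuration with `ApprM μ R₇ R₈ R₉`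
for SOME radii has, at every atom `p`, for every scale `d`, tolerance `η < 1/20`, shell gap `γ`, isometry `A` and shell assignment `t`, NO robust fcc match and
NO robust hcp match.  This is the radius-free content of the textured antecedent (the radii are the law's and unknown to a certificate). [folklore] -/
theorem not_robustGood_of_apprM {δ : ℝ} (hδ : 0 < δ) {μ : Measure E3} (hμ : IsRootedHardCore δ μ) {R₇ R₈ R₉ : ℝ} (h : ApprM μ R₇ R₈ R₉)
    {p : E3} (hp : μ {p} ≠ 0) (d η γ : ℝ) (A : EuclideanSpace ℝ (Fin 3) →ₗᵢ[ℝ] EuclideanSpace ℝ (Fin 3)) :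
    (∀ t : ↥Literature.Geometry.DiscreteGeometry.fccKissingPattern → EuclideanSpace ℝ (Fin 3),
      ¬ (0 < d ∧ 0 < γ ∧ η < 1 / 20 ∧
        (∀ u : ↥Literature.Geometry.DiscreteGeometry.fccKissingPattern, μ {t u} ≠ 0 ∧ ‖(t u - p) - d • A (u : EuclideanSpace ℝ (Fin 3))‖ ≤ η * d) ∧
        (∀ s : EuclideanSpace ℝ (Fin 3), μ {s} ≠ 0 → s ≠ p → d ≤ dist s p) ∧
        (∃ s : EuclideanSpace ℝ (Fin 3), μ {s} ≠ 0 ∧ s ≠ p ∧ dist s p ≤ d) ∧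
        (∀ s : EuclideanSpace ℝ (Fin 3), μ {s} ≠ 0 → s ≠ p → dist s p < 13 / 10 * d + γ → dist s p ≤ 13 / 10 * d - γ ∧ s ∈ Set.range t))) ∧
    (∀ t : ↥Literature.Geometry.DiscreteGeometry.hcpKissingPattern → EuclideanSpace ℝ (Fin 3),
      ¬ (0 < d ∧ 0 < γ ∧ η < 1 / 20 ∧
        (∀ u : ↥Literature.Geometry.DiscreteGeometry.hcpKissingPattern, μ {t u} ≠ 0 ∧ ‖(t u - p) - d • A (u : EuclideanSpace ℝ (Fin 3))‖ ≤ η * d) ∧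
        (∀ s : EuclideanSpace ℝ (Fin 3), μ {s} ≠ 0 → s ≠ p → d ≤ dist s p) ∧
        (∃ s : EuclideanSpace ℝ (Fin 3), μ {s} ≠ 0 ∧ s ≠ p ∧ dist s p ≤ d) ∧
        (∀ s : EuclideanSpace ℝ (Fin 3), μ {s} ≠ 0 → s ≠ p → dist s p < 13 / 10 * d + γ → dist s p ≤ 13 / 10 * d - γ ∧ s ∈ Set.range t))) :=
  not_robustGood_of_texture hδ hμ (reducedTexture_of_apprM h) hp d η γ A

/-- **Robustly good ⟹ outside the textured slot**: a rooted `δ`-hard-core configuration with ONE robustly `1/20`-good fcc atom satisfies `ApprM μ R₇ R₈ R₉` for NO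
radii (likewise hcp, `not_apprM_of_robustGood_hcp`).  Hence periodic close packings and their small strains — the only configurations the (E⋆-LB) corollary and
the near-clean objection evaluate — are not in the domain of any textured slot. [folklore] -/
theorem not_apprM_of_robustGood {δ : ℝ} (hδ : 0 < δ) {μ : Measure E3} (hμ : IsRootedHardCore δ μ) {p : E3} (hp : μ {p} ≠ 0) {d η γ : ℝ}
    {A : EuclideanSpace ℝ (Fin 3) →ₗᵢ[ℝ] EuclideanSpace ℝ (Fin 3)} {t : ↥Literature.Geometry.DiscreteGeometry.fccKissingPattern → EuclideanSpace ℝ (Fin 3)}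
    (hgood : 0 < d ∧ 0 < γ ∧ η < 1 / 20 ∧
        (∀ u : ↥Literature.Geometry.DiscreteGeometry.fccKissingPattern, μ {t u} ≠ 0 ∧ ‖(t u - p) - d • A (u : EuclideanSpace ℝ (Fin 3))‖ ≤ η * d) ∧
        (∀ s : EuclideanSpace ℝ (Fin 3), μ {s} ≠ 0 → s ≠ p → d ≤ dist s p) ∧
        (∃ s : EuclideanSpace ℝ (Fin 3), μ {s} ≠ 0 ∧ s ≠ p ∧ dist s p ≤ d) ∧
        (∀ s : EuclideanSpace ℝ (Fin 3), μ {s} ≠ 0 → s ≠ p → dist s p < 13 / 10 * d + γ → dist s p ≤ 13 / 10 * d - γ ∧ s ∈ Set.range t))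
    (R₇ R₈ R₉ : ℝ) : ¬ ApprM μ R₇ R₈ R₉ :=
  fun h => (not_robustGood_of_apprM hδ hμ h hp d η γ A).1 t hgood

/-- hcp form of `not_apprM_of_robustGood`. [folklore] -/
theorem not_apprM_of_robustGood_hcp {δ : ℝ} (hδ : 0 < δ) {μ : Measure E3} (hμ : IsRootedHardCore δ μ) {p : E3} (hp : μ {p} ≠ 0) {d η γ : ℝ}
    {A : EuclideanSpace ℝ (Fin 3) →ₗᵢ[ℝ] EuclideanSpace ℝ (Fin 3)} {t : ↥Literature.Geometry.DiscreteGeometry.hcpKissingPattern → EuclideanSpace ℝ (Fin 3)}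
    (hgood : 0 < d ∧ 0 < γ ∧ η < 1 / 20 ∧
        (∀ u : ↥Literature.Geometry.DiscreteGeometry.hcpKissingPattern, μ {t u} ≠ 0 ∧ ‖(t u - p) - d • A (u : EuclideanSpace ℝ (Fin 3))‖ ≤ η * d) ∧
        (∀ s : EuclideanSpace ℝ (Fin 3), μ {s} ≠ 0 → s ≠ p → d ≤ dist s p) ∧
        (∃ s : EuclideanSpace ℝ (Fin 3), μ {s} ≠ 0 ∧ s ≠ p ∧ dist s p ≤ d) ∧
        (∀ s : EuclideanSpace ℝ (Fin 3), μ {s} ≠ 0 → s ≠ p → dist s p < 13 / 10 * d + γ → dist s p ≤ 13 / 10 * d - γ ∧ s ∈ Set.range t))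
    (R₇ R₈ R₉ : ℝ) : ¬ ApprM μ R₇ R₈ R₉ :=
  fun h => (not_robustGood_of_apprM hδ hμ h hp d η γ A).2 t hgood

/-! ## §2. The reach theorem, general ledger form, with TEXTURED slots -/

/-- ★★ **THE REACH THEOREM WITH TEXTURED SLOTS** (#132 `coherentMassExclusion_of_floorsL`, texture threaded).  A ledger `Φ` integrable with mean `≤ 0`
under every point-stationary probability law a.s. carried by rooted `7/10`-hard-core configurations; deterministic floors `e⋆ + m_i ≤ rootEnergy μ + Φ μ`
at the rooted `7/10`-hard-core, Nash, TEXTURED (`∃ R₇ R₈ R₉, ApprM μ R₇ R₈ R₉`) configurations of row `i < n` (margins `m_i ≥ m > 0`); a deterministic cap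
`e⋆ − rootEnergy μ − Φ μ ≤ D` (`D ≥ 0`) ONLY at rooted hard-core, Nash, TEXTURED configurations lying in no row: then F(η) `CoherentMassExclusion n K η`
for every `η ≤ reach m D`.  (Clause (d) of the binder list supplies the texture almost surely.) [new: junction] -/
theorem coherentMassExclusion_of_floorsL_textured (n : ℕ) (K : ℕ → Set (MeasureTheory.Measure (EuclideanSpace ℝ (Fin 3))))
    (hK : ∀ i, MeasurableSet (K i)) (mK : ℕ → ℝ) (Φ : Measure E3 → ℝ)
    (hΦ : ∀ P : Measure (Measure E3), IsProbabilityMeasure P → (∀ᵐ μ ∂P, IsRootedHardCore (7 / 10) μ) → IsPointStationaryLaw P →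
      Integrable Φ P ∧ ∫ μ, Φ μ ∂P ≤ 0)
    (hfloorT : ∀ i < n, ∀ μ : Measure E3, IsRootedHardCore (7 / 10) μ → NashM μ → (∃ R₇ R₈ R₉ : ℝ, ApprM μ R₇ R₈ R₉) →
      μ ∈ K i → eStar + mK i ≤ rootEnergy lennardJones μ + Φ μ)
    {m D : ℝ} (hm0 : 0 < m) (hD : 0 ≤ D) (hm : ∀ i < n, m ≤ mK i)
    (hcapT : ∀ μ : Measure E3, IsRootedHardCore (7 / 10) μ → NashM μ → (∃ R₇ R₈ R₉ : ℝ, ApprM μ R₇ R₈ R₉) →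
      μ ∉ (⋃ i ∈ Finset.range n, K i) → eStar - rootEnergy lennardJones μ - Φ μ ≤ D)
    {η : ℝ} (hη : η ≤ reach m D) : CoherentMassExclusion n K η := by
  intro P
  dsimp only
  intro hP ha hb hd he h0 hmin hmass
  have h7 : (0 : ℝ) < 7 / 10 := by norm_num
  obtain ⟨hΦI, hΦ0⟩ := hΦ P hP ha hb
  obtain ⟨R₇, R₈, R₉, hd'⟩ := hd
  have happr : ∀ᵐ μ ∂P, ApprM μ R₇ R₈ R₉ := hd'.mono fun μ hμ => hμ
  have hnash : ∀ᵐ μ ∂P, NashM μ := he.mono fun μ hμ => hμ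
  have hfl : ∀ i < n, ∀ᵐ μ ∂P, μ ∈ K i → eStar + mK i ≤ rootEnergy lennardJones μ + Φ μ := fun i hi => by
    filter_upwards [ha, hnash, happr] with μ hμ hN hT hμi using hfloorT i hi μ hμ hN ⟨R₇, R₈, R₉, hT⟩ hμi
  have hcp : ∀ᵐ μ ∂P, μ ∉ (⋃ i ∈ Finset.range n, K i) → eStar - rootEnergy lennardJones μ - Φ μ ≤ D := by
    filter_upwards [ha, hnash, happr] with μ hμ hN hT hμU using hcapT μ hμ hN ⟨R₇, R₈, R₉, hT⟩ hμU
  have hlt : eStar < ∫ μ, rootEnergy lennardJones μ ∂P :=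
    lt_integral_rootEnergy_of_massLedger h7 ha hΦI hΦ0 hK hm0 hD hm hfl hcp (lt_of_lt_of_le hmass hη)
  exact absurd hmin (not_le.2 hlt)

/-- ★ JUNCTION TO THE CRUX ((404) `aperiodicFrustratedLawGap_of_massSplit`, by name): textured floors, the textured cap, a null ledger, and A(η) at some
`η ≤ reach m D`. [new: junction] -/
theorem aperiodicFrustratedLawGap_of_offAtlasMassGapL_textured (n : ℕ) (K : ℕ → Set (MeasureTheory.Measure (EuclideanSpace ℝ (Fin 3))))
    (hK : ∀ i, MeasurableSet (K i)) (mK : ℕ → ℝ) (Φ : Measure E3 → ℝ)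
    (hΦ : ∀ P : Measure (Measure E3), IsProbabilityMeasure P → (∀ᵐ μ ∂P, IsRootedHardCore (7 / 10) μ) → IsPointStationaryLaw P →
      Integrable Φ P ∧ ∫ μ, Φ μ ∂P ≤ 0)
    (hfloorT : ∀ i < n, ∀ μ : Measure E3, IsRootedHardCore (7 / 10) μ → NashM μ → (∃ R₇ R₈ R₉ : ℝ, ApprM μ R₇ R₈ R₉) →
      μ ∈ K i → eStar + mK i ≤ rootEnergy lennardJones μ + Φ μ)
    {m D : ℝ} (hm0 : 0 < m) (hD : 0 ≤ D) (hm : ∀ i < n, m ≤ mK i)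
    (hcapT : ∀ μ : Measure E3, IsRootedHardCore (7 / 10) μ → NashM μ → (∃ R₇ R₈ R₉ : ℝ, ApprM μ R₇ R₈ R₉) →
      μ ∉ (⋃ i ∈ Finset.range n, K i) → eStar - rootEnergy lennardJones μ - Φ μ ≤ D)
    {η : ℝ} (hη : η ≤ reach m D) (hA : OffAtlasMassGap n K η) :
    Summit.AtomisticToContinuum.Crystallization.Theses.FrustratedLawDichotomy.AperiodicFrustratedLawGap :=
  aperiodicFrustratedLawGap_of_massSplit n K η (coherentMassExclusion_of_floorsL_textured n K hK mK Φ hΦ hfloorT hm0 hD hm hcapT hη) hA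

/-! ## §3. Symmetric currency ((473) `…SymSharing`) with textured slots -/

/-- ★★ **THE REACH THEOREM IN SYMMETRIC CURRENCY, TEXTURED SLOTS** ((473) `coherentMassExclusion_of_symAvg`, texture threaded).  For any radius `r > 0`:
row floors `e⋆ + m_i ≤ symAvgEnergy r μ` at the rooted `7/10`-hard-core, Nash, TEXTURED configurations of row `i < n` (margins `≥ m > 0`), and the cap
`e⋆ − symAvgEnergy r μ ≤ D` (`D ≥ 0`) ONLY at rooted hard-core, Nash, TEXTURED configurations outside every row, prove F(η) for every `η ≤ reach m D`.
[new: junction] -/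
theorem coherentMassExclusion_of_symAvg_textured {r : ℝ} (hr : 0 < r) (n : ℕ) (K : ℕ → Set (MeasureTheory.Measure (EuclideanSpace ℝ (Fin 3))))
    (hK : ∀ i, MeasurableSet (K i)) (mK : ℕ → ℝ)
    (hfloorT : ∀ i < n, ∀ μ : Measure E3, IsRootedHardCore (7 / 10) μ → NashM μ → (∃ R₇ R₈ R₉ : ℝ, ApprM μ R₇ R₈ R₉) →
      μ ∈ K i → eStar + mK i ≤ symAvgEnergy r μ)
    {m D : ℝ} (hm0 : 0 < m) (hD : 0 ≤ D) (hm : ∀ i < n, m ≤ mK i)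
    (hcapT : ∀ μ : Measure E3, IsRootedHardCore (7 / 10) μ → NashM μ → (∃ R₇ R₈ R₉ : ℝ, ApprM μ R₇ R₈ R₉) →
      μ ∉ (⋃ i ∈ Finset.range n, K i) → eStar - symAvgEnergy r μ ≤ D)
    {η : ℝ} (hη : η ≤ reach m D) : CoherentMassExclusion n K η := by
  obtain ⟨H, hHm, hH⟩ := exists_measurable_rootEnergy_surrogate (-(250 / 12 * (10 / 7) ^ 6))
  refine coherentMassExclusion_of_floorsL_textured n K hK mK (net (symShare r H) fun _ _ => 0) (symShare_nullLedger hr hHm hH)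
    (fun i hi μ hμ hN hT hμi => ?_) hm0 hD hm (fun μ hμ hN hT hμU => ?_) hη
  · rw [transported_eq_symAvgEnergy hr hH hμ]
    exact hfloorT i hi μ hμ hN hT hμi
  · rw [sub_sub, transported_eq_symAvgEnergy hr hH hμ]
    exact hcapT μ hμ hN hT hμU

/-- ★★ JUNCTION TO THE CRUX, symmetric currency, textured slots: floors, cap and A(η) = `OffAtlasMassGap n K η` (`η ≤ reach m D`) ⟹ `AperiodicFrustratedLawGap`
((404) `aperiodicFrustratedLawGap_of_massSplit`, by name). [new: junction] -/
theorem aperiodicFrustratedLawGap_of_offAtlasMassGap_symAvg_textured {r : ℝ} (hr : 0 < r) (n : ℕ)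
    (K : ℕ → Set (MeasureTheory.Measure (EuclideanSpace ℝ (Fin 3)))) (hK : ∀ i, MeasurableSet (K i)) (mK : ℕ → ℝ)
    (hfloorT : ∀ i < n, ∀ μ : Measure E3, IsRootedHardCore (7 / 10) μ → NashM μ → (∃ R₇ R₈ R₉ : ℝ, ApprM μ R₇ R₈ R₉) →
      μ ∈ K i → eStar + mK i ≤ symAvgEnergy r μ)
    {m D : ℝ} (hm0 : 0 < m) (hD : 0 ≤ D) (hm : ∀ i < n, m ≤ mK i)
    (hcapT : ∀ μ : Measure E3, IsRootedHardCore (7 / 10) μ → NashM μ → (∃ R₇ R₈ R₉ : ℝ, ApprM μ R₇ R₈ R₉) →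
      μ ∉ (⋃ i ∈ Finset.range n, K i) → eStar - symAvgEnergy r μ ≤ D)
    {η : ℝ} (hη : η ≤ reach m D) (hA : OffAtlasMassGap n K η) :
    Summit.AtomisticToContinuum.Crystallization.Theses.FrustratedLawDichotomy.AperiodicFrustratedLawGap :=
  aperiodicFrustratedLawGap_of_massSplit n K η (coherentMassExclusion_of_symAvg_textured hr n K hK mK hfloorT hm0 hD hm hcapT hη) hA

/-- ★ THE ENERGY–MASS INEQUALITY, symmetric currency, textured slots — clauses (a), (b), (d), (e): textured floors on the rows (margins `≥ m`), the textured
cap off the rows, `0 < m + D`; then every point-stationary probability law that is a.s. rooted `7/10`-hard-core, a.s. Nash and a.s. textured (`ApprM _ R₇ R₈ R₉`)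
with `E_P[rootEnergy] ≤ e⋆ + ε` gives the uncovered set mass `≥ (m − ε)/(m + D)`. [new: junction] -/
theorem offAtlasMass_ge_of_symAvg_textured {r : ℝ} (hr : 0 < r) (n : ℕ) (K : ℕ → Set (MeasureTheory.Measure (EuclideanSpace ℝ (Fin 3))))
    (hK : ∀ i, MeasurableSet (K i)) (mK : ℕ → ℝ)
    (hfloorT : ∀ i < n, ∀ μ : Measure E3, IsRootedHardCore (7 / 10) μ → NashM μ → (∃ R₇ R₈ R₉ : ℝ, ApprM μ R₇ R₈ R₉) →
      μ ∈ K i → eStar + mK i ≤ symAvgEnergy r μ)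
    {m D : ℝ} (hmD : 0 < m + D) (hm : ∀ i < n, m ≤ mK i)
    (hcapT : ∀ μ : Measure E3, IsRootedHardCore (7 / 10) μ → NashM μ → (∃ R₇ R₈ R₉ : ℝ, ApprM μ R₇ R₈ R₉) →
      μ ∉ (⋃ i ∈ Finset.range n, K i) → eStar - symAvgEnergy r μ ≤ D)
    (P : Measure (Measure E3)) [IsProbabilityMeasure P] (ha : ∀ᵐ μ ∂P, IsRootedHardCore (7 / 10) μ) (hb : IsPointStationaryLaw P)
    {R₇ R₈ R₉ : ℝ} (hd : ∀ᵐ μ ∂P, ApprM μ R₇ R₈ R₉) (he : ∀ᵐ μ ∂P, NashM μ)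
    {ε : ℝ} (hmean : ∫ μ, rootEnergy lennardJones μ ∂P ≤ eStar + ε) :
    (m - ε) / (m + D) ≤ P.real (⋃ i ∈ Finset.range n, K i)ᶜ := by
  obtain ⟨H, hHm, hH⟩ := exists_measurable_rootEnergy_surrogate (-(250 / 12 * (10 / 7) ^ 6))
  have h7 : (0 : ℝ) < 7 / 10 := by norm_num
  obtain ⟨hΦI, hΦ0⟩ := symShare_nullLedger hr hHm hH P inferInstance ha hb
  refine offAtlasMass_ge_of_atlasLedger (integrable_rootEnergy_of_ae_hardCore h7 ha) hΦI hΦ0 hK hmD hm (fun i hi => ?_) ?_ hmean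
  · filter_upwards [ha, he, hd] with μ hμ hN hT hμi
    rw [transported_eq_symAvgEnergy hr hH hμ]
    exact hfloorT i hi μ hμ hN ⟨R₇, R₈, R₉, hT⟩ hμi
  · filter_upwards [ha, he, hd] with μ hμ hN hT hμU
    rw [sub_sub, transported_eq_symAvgEnergy hr hH hμ]
    exact hcapT μ hμ hN ⟨R₇, R₈, R₉, hT⟩ hμU

/-! ## §4. The textured strict door and the local frustration inequality -/

/-- ★★ **THE TEXTURED STRICT DOOR (A-free).**  Symmetric-currency floors on the rows at textured Nash roots (margins `≥ m > 0`) and a STRICT gap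
`e⋆ + g ≤ symAvgEnergy r μ` (`g > 0`) at every rooted `7/10`-hard-core, Nash, TEXTURED configuration OUTSIDE the rows prove the crux outright (the complement
becomes a row, the cap is vacuous, `reach = 1`, A(1) trivial — the proof of (473) `aperiodicFrustratedLawGap_of_symGap` verbatim over the textured reach theorem).
Unlike its texture-blind parent, this door has NO near-clean configuration in its domain (§1 `not_apprM_of_robustGood`). [new: junction] -/
theorem aperiodicFrustratedLawGap_of_texturedSymGap {r : ℝ} (hr : 0 < r) (n : ℕ) (K : ℕ → Set (MeasureTheory.Measure (EuclideanSpace ℝ (Fin 3))))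
    (hK : ∀ i, MeasurableSet (K i)) (mK : ℕ → ℝ)
    (hfloorT : ∀ i < n, ∀ μ : Measure E3, IsRootedHardCore (7 / 10) μ → NashM μ → (∃ R₇ R₈ R₉ : ℝ, ApprM μ R₇ R₈ R₉) →
      μ ∈ K i → eStar + mK i ≤ symAvgEnergy r μ)
    {m g : ℝ} (hm0 : 0 < m) (hm : ∀ i < n, m ≤ mK i) (hg : 0 < g)
    (hgapT : ∀ μ : Measure E3, IsRootedHardCore (7 / 10) μ → NashM μ → (∃ R₇ R₈ R₉ : ℝ, ApprM μ R₇ R₈ R₉) →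
      μ ∉ (⋃ i ∈ Finset.range n, K i) → eStar + g ≤ symAvgEnergy r μ) :
    Summit.AtomisticToContinuum.Crystallization.Theses.FrustratedLawDichotomy.AperiodicFrustratedLawGap := by
  have hU := iUnion_extendRow_eq_univ n K
  have hF : CoherentMassExclusion (n + 1) (extendRow n K) 1 := by
    refine coherentMassExclusion_of_symAvg_textured hr (n + 1) (extendRow n K) (measurableSet_extendRow hK) (extendMargin n mK g)
      (fun i hi μ hμ hN hT hμi => ?_) (m := min m g) (D := 0) (lt_min hm0 hg) le_rfl (fun i hi => ?_) (fun μ hμ hN hT hμU => ?_) (η := 1) ?_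
    · by_cases hi' : i < n
      · unfold extendRow at hμi; unfold extendMargin; rw [if_pos hi'] at hμi ⊢
        exact hfloorT i hi' μ hμ hN hT hμi
      · have hin : i = n := by omega
        subst hin
        unfold extendRow at hμi; unfold extendMargin; rw [if_neg (lt_irrefl i)] at hμi ⊢
        exact hgapT μ hμ hN hT hμi
    · unfold extendMargin
      by_cases hi' : i < n
      · rw [if_pos hi']; exact (min_le_left _ _).trans (hm i hi')
      · rw [if_neg hi']; exact min_le_right _ _
    · exact absurd (eq_univ_iff_forall.mp hU μ) hμU
    · unfold reach
      rw [add_zero, div_self (lt_min hm0 hg).ne']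
  have hA : OffAtlasMassGap (n + 1) (extendRow n K) 1 := by
    unfold OffAtlasMassGap
    refine noAdmissibleMinimiserWith_of_forall_not fun P hP => ?_
    have hP' : (1 : ℝ) ≤ P.real (⋃ i ∈ Finset.range (n + 1), extendRow n K i)ᶜ := hP
    rw [hU, compl_univ, measureReal_empty] at hP'
    exact absurd hP' (by norm_num)
  exact aperiodicFrustratedLawGap_of_massSplit (n + 1) (extendRow n K) 1 hF hA

/-- ★ **THE LOCAL FRUSTRATION INEQUALITY CLOSES THE CRUX** (row-free case of the textured strict door):
  (LFI)(r, g)  every rooted `7/10`-hard-core, Nash, TEXTURED (`∃ R₇ R₈ R₉, ApprM μ R₇ R₈ R₉`) configuration has `e⋆ + g ≤ symAvgEnergy r μ`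
for some `r > 0`, `g > 0` ⟹ `AperiodicFrustratedLawGap`.  Law-free and single-configuration; a certificate discharges `eUp + g ≤ symAvgEnergy r μ` against the
tree ceiling `e⋆ ≤ eUp` and therefore proves NO lower bound on `e⋆` (no untextured configuration is in the domain).  UNDECIDED; its binding adversary is the
cheapest all-`1/20`-bad Nash environment. [new: junction] -/
theorem aperiodicFrustratedLawGap_of_texturedLocalGap {r : ℝ} (hr : 0 < r) {g : ℝ} (hg : 0 < g)
    (hLFI : ∀ μ : Measure E3, IsRootedHardCore (7 / 10) μ → NashM μ → (∃ R₇ R₈ R₉ : ℝ, ApprM μ R₇ R₈ R₉) → eStar + g ≤ symAvgEnergy r μ) :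
    Summit.AtomisticToContinuum.Crystallization.Theses.FrustratedLawDichotomy.AperiodicFrustratedLawGap :=
  aperiodicFrustratedLawGap_of_texturedSymGap hr 0 (fun _ => ∅) (fun _ => MeasurableSet.empty) (fun _ => g)
    (fun i hi => absurd hi (Nat.not_lt_zero i)) hg (fun i hi => absurd hi (Nat.not_lt_zero i)) hg
    (fun μ hμ hN hT _ => hLFI μ hμ hN hT)

/-! ## §5. Composition with the ergodic residual (#135) and the kernel-checked weakening direction -/

/-- ★ **THE COMBINED DOOR — texture on the F side, ergodicity on the A side** (both almost-sure clauses of the same binder list): textured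
symmetric-currency floors and cap (`η ≤ reach m D`) give F(η) (§3), and the ERGODIC restriction of A(η) (hand 2's #135
`aperiodicFrustratedLawGap_of_massSplit_ergodic`, ergodicity clause of `S_aperiodicErgodicGap` verbatim) closes the crux BY NAME. [new: junction] -/
theorem aperiodicFrustratedLawGap_of_ergodicOffAtlasMassGap_symAvg_textured {r : ℝ} (hr : 0 < r) (n : ℕ)
    (K : ℕ → Set (MeasureTheory.Measure (EuclideanSpace ℝ (Fin 3)))) (hK : ∀ i, MeasurableSet (K i)) (mK : ℕ → ℝ)
    (hfloorT : ∀ i < n, ∀ μ : Measure E3, IsRootedHardCore (7 / 10) μ → NashM μ → (∃ R₇ R₈ R₉ : ℝ, ApprM μ R₇ R₈ R₉) →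
      μ ∈ K i → eStar + mK i ≤ symAvgEnergy r μ)
    {m D : ℝ} (hm0 : 0 < m) (hD : 0 ≤ D) (hm : ∀ i < n, m ≤ mK i)
    (hcapT : ∀ μ : Measure E3, IsRootedHardCore (7 / 10) μ → NashM μ → (∃ R₇ R₈ R₉ : ℝ, ApprM μ R₇ R₈ R₉) →
      μ ∉ (⋃ i ∈ Finset.range n, K i) → eStar - symAvgEnergy r μ ≤ D)
    {η : ℝ} (hη : η ≤ reach m D)
    (hAerg : NoAdmissibleMinimiserWith fun P => η ≤ P.real (⋃ i ∈ Finset.range n, K i)ᶜ ∧ ∀ A : Set (Measure E3), MeasurableSet A →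
      (∀ μ : Measure E3, ∀ p : E3, μ {p} ≠ 0 → (μ ∈ A ↔ Measure.map (fun z : E3 => z - p) μ ∈ A)) → P A = 0 ∨ P Aᶜ = 0) :
    Summit.AtomisticToContinuum.Crystallization.Theses.FrustratedLawDichotomy.AperiodicFrustratedLawGap :=
  aperiodicFrustratedLawGap_of_massSplit_ergodic n K hK η (coherentMassExclusion_of_symAvg_textured hr n K hK mK hfloorT hm0 hD hm hcapT hη) hAerg

/-- **The weakening direction, kernel-checked (USE example)**: the texture-BLIND hypotheses of (473)'s strict door `aperiodicFrustratedLawGap_of_symGap`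
feed the TEXTURED door verbatim (the texture antecedent is simply dropped), so every blind certificate remains a textured certificate.  (An `example`,
not a theorem: the statement coincides with the landed blind door and must not be re-declared.) [new: bookkeeping] -/
example {r : ℝ} (hr : 0 < r) (n : ℕ) (K : ℕ → Set (MeasureTheory.Measure (EuclideanSpace ℝ (Fin 3))))
    (hK : ∀ i, MeasurableSet (K i)) (mK : ℕ → ℝ)
    (hfloorS : ∀ i < n, ∀ μ : Measure E3, IsRootedHardCore (7 / 10) μ →
      (∀ p : E3, μ {p} ≠ 0 → ∀ y : E3, (∀ q : E3, μ {q} ≠ 0 → q ≠ p → y ≠ q) →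
        ∑' q : {q : E3 // μ {q} ≠ 0 ∧ q ≠ p}, lennardJones (dist p (q : E3)) ≤ ∑' q : {q : E3 // μ {q} ≠ 0 ∧ q ≠ p}, lennardJones (dist y (q : E3))) →
      μ ∈ K i → eStar + mK i ≤ symAvgEnergy r μ)
    {m g : ℝ} (hm0 : 0 < m) (hm : ∀ i < n, m ≤ mK i) (hg : 0 < g)
    (hgapS : ∀ μ : Measure E3, IsRootedHardCore (7 / 10) μ →
      (∀ p : E3, μ {p} ≠ 0 → ∀ y : E3, (∀ q : E3, μ {q} ≠ 0 → q ≠ p → y ≠ q) →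
        ∑' q : {q : E3 // μ {q} ≠ 0 ∧ q ≠ p}, lennardJones (dist p (q : E3)) ≤ ∑' q : {q : E3 // μ {q} ≠ 0 ∧ q ≠ p}, lennardJones (dist y (q : E3))) →
      μ ∉ (⋃ i ∈ Finset.range n, K i) → eStar + g ≤ symAvgEnergy r μ) :
    Summit.AtomisticToContinuum.Crystallization.Theses.FrustratedLawDichotomy.AperiodicFrustratedLawGap :=
  aperiodicFrustratedLawGap_of_texturedSymGap hr n K hK mK (fun i hi μ hμ hN _ hμi => hfloorS i hi μ hμ hN hμi) hm0 hm hg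
    (fun μ hμ hN _ hμU => hgapS μ hμ hN hμU)

end Summit.AtomisticToContinuum.Crystallization.Theorems.FrustratedLawDichotomyAtlasReachTextured

end
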